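import Summits.CriticalPhenomena.PercolationContinuityZ3.Theorems.PercNearOneGluingNoHeavyLowerTailSahiTwoChainCaps
import HarnessLib

/-!
# Sahi positivity of EVERY ORDER for the PRINCIPAL cluster events `{C_s ⊇ T}` of a weighted cycle

Support file for the Sahi programme (`--supports stmt-CriticalPhenomena-4575`, prover prim-sahi-p2 gen 9).
No definitions, no named facts, no sorries; standard axioms.  Memo `…/prim-sahi-p2/PROOF-E3.md` §20.

Gen 8 (`…IncStarCycle*.lean`) proved `E_n ≥ 0` for the POINT events `{s ↔ t}` and the group (cup) events
`{s ↔ T} = ⋃_{t∈T}{s ↔ t}` of a weighted cycle.  Here: the PRINCIPAL (cap) events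
`{C_s ⊇ T} = ⋂_{t∈T} {s ↔ t}` — the events needed by the all-orders cut-vertex theorem
(`…SahiPrincipalCutVertex.lean`): with it, every CACTUS graph has all its principal cluster events Sahi-positive
at every order.

* `sahiE_principal_cycle_nonneg` — cycle `Fin m` (`m ≥ 3`), weights vanishing off the edges `s(j, j+1)`, root `0`:
  `0 ≤ E_n(1_{C_0 ⊇ T_0}, …, 1_{C_0 ⊇ T_{n-1}})` for all `n` and all finite `T_i ⊆ Fin m`.
* `sahiE_principal_embeddedCycle_nonneg(_rooted)` — the same for a cycle embedded by an injective
  `c : Fin m → V` into a larger vertex set (events `⋂_{t∈T} {c s ↔ c t in range c}`, any root `c s`) — the block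
  input of the cut-vertex theorem.

**Proof.**  On configurations of positive weight `{0 ↔ t} = R t ∪ L t` (the two arcs, gen 8
`IncStarCycle.openConn_iff_arcs`); `R` is antitone, `L` monotone, and `R v ⊥ L v'` for `v ≤ v'` (disjoint edge
sets).  The abstract theorem `TwoChainCaps.sahiE_nonneg_of_twoChainCaps` (staircase recursion: cap probabilities
only involve the pairs `P(R v ∩ L v')`, `v ≤ v'`, hence agree with those of the PRODUCT of the two arc-length laws,
where Lieb–Sahi's two-chain theorem applies) gives the claim; the embedded form pulls back along `Sym2.map c`
(gen 8 `IncStarCycle.openConnIn_range_iff_pullback`, `prodBernoulli_map_pullback`).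
-/

noncomputable section

namespace Summit.CriticalPhenomena.PercolationContinuityZ3.Theorems

namespace IncStarCycle

open Finset MeasureTheory Literature.Combinatorics.Sahi2008 Literature.Probability.Percolation
  Literature.Probability.LatticeModels
open Literature.Probability.Percolation.DecisionTree (ind ind_of_mem ind_of_not_mem ind_nonneg)
open scoped Classical

variable {m : ℕ} [NeZero m]

/-- An event is determined by `F` iff its complement is (plumbing). [folklore] -/
private theorem determinedBy_of_compl {ι : Type*} {A : Set (Set ι)} {F : Set ι} (h : DeterminedBy Aᶜ F) :
    DeterminedBy A F := by
  rw [determinedBy_iff] at h ⊢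
  intro ω ω' hF
  have := h ω ω' hF
  simp only [Set.mem_compl_iff, not_iff_not] at this
  exact this

/-- For `v ≤ v'` the right arc to `v` and the left arc to `v'` are independent (disjoint edge sets).
[this work] -/
theorem ex_ind_rightArc_mul_leftArc (hm : 3 ≤ m) (w : Sym2 (Fin m) → unitInterval) {v v' : Fin m}
    (hvv' : v ≤ v') :
    ex (bernoulliWeight w)
        (ind {ω : BondConfig (Fin m) | ∀ j : Fin m, j.val < v.val → s(j, j + 1) ∈ ω} *
          ind {ω : BondConfig (Fin m) | ∀ j : Fin m, v'.val ≤ j.val → s(j, j + 1) ∈ ω}) =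
      ex (bernoulliWeight w) (ind {ω : BondConfig (Fin m) | ∀ j : Fin m, j.val < v.val → s(j, j + 1) ∈ ω}) *
        ex (bernoulliWeight w) (ind {ω : BondConfig (Fin m) | ∀ j : Fin m, v'.val ≤ j.val → s(j, j + 1) ∈ ω}) := by
  have hprod : ind {ω : BondConfig (Fin m) | ∀ j : Fin m, j.val < v.val → s(j, j + 1) ∈ ω} *
      ind {ω : BondConfig (Fin m) | ∀ j : Fin m, v'.val ≤ j.val → s(j, j + 1) ∈ ω} =
      ind ({ω : BondConfig (Fin m) | ∀ j : Fin m, j.val < v.val → s(j, j + 1) ∈ ω} ∩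
        {ω | ∀ j : Fin m, v'.val ≤ j.val → s(j, j + 1) ∈ ω}) := by
    funext ω; exact (BHK2006.ind_inter _ _ ω).symm
  rw [hprod, ex_bernoulliWeight_ind, ex_bernoulliWeight_ind, ex_bernoulliWeight_ind]
  refine prodBernoulli_real_inter_of_determinedBy_disjoint w ?_
    (determinedBy_of_compl (determinedBy_rightArc_compl v))
    (determinedBy_of_compl (determinedBy_leftArc_compl v')) MeasurableSet.of_discrete MeasurableSet.of_discrete
  rw [Finset.disjoint_left]
  intro e he he'
  simp only [mem_image, mem_filter, mem_univ, true_and] at he he'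
  obtain ⟨j, hj, rfl⟩ := he
  obtain ⟨k, hk, hjk⟩ := he'
  have := cycEdge_injective hm hjk
  subst this
  have := Fin.le_def.1 hvv'
  omega

/-- **Sahi positivity of every order for the principal cluster events of a weighted cycle.**  Let `m ≥ 3` and
let the weight `w` on the pairs of `Fin m` vanish off the cycle edges `s(j, j+1)`.  Then for every `n` and all
finite target sets `T_i ⊆ Fin m`, `0 ≤ E_n(1_{C_0 ⊇ T_0}, …, 1_{C_0 ⊇ T_{n−1}})`, `{C_0 ⊇ T} = ⋂_{t∈T}{0 ↔ t}`,
under the product weight `bernoulliWeight w`. [this work] -/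
theorem sahiE_principal_cycle_nonneg (hm : 3 ≤ m) (w : Sym2 (Fin m) → unitInterval)
    (hw : ∀ e : Sym2 (Fin m), (∀ j : Fin m, e ≠ s(j, j + 1)) → w e = 0) (n : ℕ)
    (T : Fin n → Finset (Fin m)) :
    0 ≤ sahiE (bernoulliWeight w) n
      (fun i => ind (⋂ t ∈ T i, (openConn (0 : Fin m) t : Set (BondConfig (Fin m))))) := by
  -- the two arc families
  let R : Fin m → Set (BondConfig (Fin m)) := fun v => {ω | ∀ j : Fin m, j.val < v.val → s(j, j + 1) ∈ ω}
  let L : Fin m → Set (BondConfig (Fin m)) := fun v => {ω | ∀ j : Fin m, v.val ≤ j.val → s(j, j + 1) ∈ ω}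
  -- the arc form of the events, valid on configurations of positive weight
  have harc : ∀ ω : BondConfig (Fin m), bernoulliWeight w ω ≠ 0 → ∀ v : Fin m,
      (ω ∈ openConn (0 : Fin m) v ↔ ω ∈ R v ∪ L v) := by
    intro ω hω v
    refine openConn_iff_arcs (by omega) (fun u u' hadj => ?_) v
    by_cases hne : ∃ k : Fin m, s(u, u') = s(k, k + 1)
    · exact hne
    · exfalso
      rw [openGraph_adj] at hadj
      exact hω (bernoulliWeight_eq_zero_of_mem w hadj.1 (hw _ fun j hj => hne ⟨j, hj⟩))
  have hcap : ∀ ω : BondConfig (Fin m), bernoulliWeight w ω ≠ 0 → ∀ U : Finset (Fin m),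
      (ω ∈ (⋂ t ∈ U, (openConn (0 : Fin m) t : Set (BondConfig (Fin m)))) ↔ ω ∈ (⋂ t ∈ U, (R t ∪ L t))) := by
    intro ω hω U
    simp only [Set.mem_iInter]
    exact forall₂_congr fun t _ => harc ω hω t
  -- product moments agree, hence `E_n` agrees
  have hmom : ∀ S : Finset (Fin n),
      ex (bernoulliWeight w) (∏ i ∈ S, ind (⋂ t ∈ T i, (openConn (0 : Fin m) t : Set (BondConfig (Fin m))))) =
        ex (bernoulliWeight w) (∏ i ∈ S, ind (⋂ t ∈ T i, (R t ∪ L t))) := by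
    intro S
    rw [ex_def, ex_def]
    refine Finset.sum_congr rfl fun ω _ => ?_
    by_cases hω : bernoulliWeight w ω = 0
    · rw [hω, zero_mul, zero_mul]
    · congr 1
      rw [Finset.prod_apply, Finset.prod_apply]
      refine Finset.prod_congr rfl fun i _ => ?_
      by_cases h : ω ∈ (⋂ t ∈ T i, (openConn (0 : Fin m) t : Set (BondConfig (Fin m))))
      · rw [ind_of_mem h, ind_of_mem ((hcap ω hω (T i)).1 h)]
      · rw [ind_of_not_mem h, ind_of_not_mem (fun h' => h ((hcap ω hω (T i)).2 h'))]
  rw [TwoChainUnions.sahiE_congr_of_prodMoments (bernoulliWeight w) (bernoulliWeight w) n _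
    (fun i => ind (⋂ t ∈ T i, (R t ∪ L t))) hmom]
  -- the two-chain cap theorem
  exact TwoChainCaps.sahiE_nonneg_of_twoChainCaps (bernoulliWeight w)
    (isFKGMeasure_bernoulliWeight w).nonneg (sum_bernoulliWeight w) R L
    (fun v v' h _ hω j hj => hω j (lt_of_lt_of_le hj (Fin.le_def.1 h)))
    (fun v v' h _ hω j hj => hω j (le_trans (Fin.le_def.1 h) hj))
    (fun v v' hvv' => ex_ind_rightArc_mul_leftArc hm w hvv') n T

/-! ### Embedded cycles (relative form) -/

variable {V : Type*} [Fintype V]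

/-- **Principal cluster events of an EMBEDDED weighted cycle, every order.**  Let `c : Fin m → V` be injective
(`m ≥ 3`) and let `w` vanish on the non-consecutive pairs of the image.  Then for every `n` and all finite
`T_i ⊆ Fin m`, `0 ≤ E_n(1_{⋂_{t∈T_0}{c 0 ↔ c t in range c}}, …)` under `bernoulliWeight w`. [this work] -/
theorem sahiE_principal_embeddedCycle_nonneg (hm : 3 ≤ m) {c : Fin m → V} (hc : Function.Injective c)
    (w : Sym2 V → unitInterval)
    (hw : ∀ i j : Fin m, (∀ k : Fin m, s(i, j) ≠ s(k, k + 1)) → w s(c i, c j) = 0)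
    (n : ℕ) (T : Fin n → Finset (Fin m)) :
    0 ≤ sahiE (bernoulliWeight w) n
      (fun i => ind (⋂ t ∈ T i, (openConnIn (Set.range c) (c 0) (c t) : Set (BondConfig V)))) := by
  set Ψ : BondConfig V → BondConfig (Fin m) := fun ω => {z : Sym2 (Fin m) | Sym2.map c z ∈ ω} with hΨ
  have hΨm : Measurable Ψ := by
    refine measurable_set_iff.2 fun z => ?_
    exact measurable_set_mem (Sym2.map c z)
  have hmom : ∀ S : Finset (Fin n),
      ex (bernoulliWeight w) (∏ i ∈ S, ind (⋂ t ∈ T i, (openConnIn (Set.range c) (c 0) (c t) : Set (BondConfig V)))) =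
        ex (bernoulliWeight (w ∘ Sym2.map c))
          (∏ i ∈ S, ind (⋂ t ∈ T i, (openConn (0 : Fin m) t : Set (BondConfig (Fin m))))) := by
    intro S
    rw [prod_ind_eq_ind_iInter, prod_ind_eq_ind_iInter, ex_bernoulliWeight_ind, ex_bernoulliWeight_ind]
    have hpre : (⋂ i ∈ S, ⋂ t ∈ T i, (openConnIn (Set.range c) (c 0) (c t) : Set (BondConfig V))) =
        Ψ ⁻¹' (⋂ i ∈ S, ⋂ t ∈ T i, (openConn (0 : Fin m) t : Set (BondConfig (Fin m)))) := by
      ext ω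
      simp only [Set.mem_iInter, Set.mem_preimage]
      exact forall₂_congr fun i _ => forall₂_congr fun t _ => openConnIn_range_iff_pullback hc ω 0 t
    rw [hpre, measureReal_def, measureReal_def, ← Measure.map_apply hΨm MeasurableSet.of_discrete,
      prodBernoulli_map_pullback hc]
  rw [TwoChainUnions.sahiE_congr_of_prodMoments (bernoulliWeight w) (bernoulliWeight (w ∘ Sym2.map c)) n _
    (fun i => ind (⋂ t ∈ T i, (openConn (0 : Fin m) t : Set (BondConfig (Fin m))))) hmom]
  refine sahiE_principal_cycle_nonneg hm (w ∘ Sym2.map c) (fun e he => ?_) n T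
  induction e using Sym2.ind with
  | _ i j => exact hw i j he

/-- **Any root on the embedded cycle**: `0 ≤ E_n(1_{⋂_{t∈T_i}{c s ↔ c t in range c}})` for every root index `s`.
[this work] -/
theorem sahiE_principal_embeddedCycle_nonneg_rooted (hm : 3 ≤ m) {c : Fin m → V}
    (hc : Function.Injective c) (w : Sym2 V → unitInterval)
    (hw : ∀ i j : Fin m, (∀ k : Fin m, s(i, j) ≠ s(k, k + 1)) → w s(c i, c j) = 0)
    (s : Fin m) (n : ℕ) (T : Fin n → Finset (Fin m)) :
    0 ≤ sahiE (bernoulliWeight w) n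
      (fun i => ind (⋂ t ∈ T i, (openConnIn (Set.range c) (c s) (c t) : Set (BondConfig V)))) := by
  set c' : Fin m → V := fun i => c (i + s) with hc'
  have hc'i : Function.Injective c' := fun i j h => add_right_cancel (hc h)
  have hrange : Set.range c' = Set.range c := by
    ext x
    constructor
    · rintro ⟨i, rfl⟩; exact ⟨i + s, rfl⟩
    · rintro ⟨i, rfl⟩; exact ⟨i - s, by simp [hc']⟩
  have hw' : ∀ i j : Fin m, (∀ k : Fin m, s(i, j) ≠ s(k, k + 1)) → w s(c' i, c' j) = 0 := by
    intro i j hij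
    refine hw (i + s) (j + s) fun k hk => hij (k - s) ?_
    have h2 := congrArg (Sym2.map fun x : Fin m => x - s) hk
    simp only [Sym2.map_mk, add_sub_cancel_right] at h2
    rw [h2, add_sub_right_comm]
  have key := sahiE_principal_embeddedCycle_nonneg hm hc'i w hw' n (fun i => (T i).image fun t => t - s)
  have hT : ∀ i, (⋂ t ∈ (T i).image (fun t => t - s), (openConnIn (Set.range c') (c' 0) (c' t) : Set (BondConfig V)))
      = ⋂ t ∈ T i, (openConnIn (Set.range c) (c s) (c t) : Set (BondConfig V)) := by
    intro i
    rw [Finset.set_biInter_finset_image, hrange]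
    refine Set.iInter_congr fun t => Set.iInter_congr fun _ => ?_
    simp [hc']
  simp only [hT] at key
  exact key

/-- **Block form** (the hypothesis shape of `SahiPrincipalCutVertex.sahiE_principal_of_cutVertex` with
`V₂ = range c`, `a = c s`): targets given as finite subsets of `V` inside the image. [this work] -/
theorem sahiE_principal_embeddedCycle_block (hm : 3 ≤ m) {c : Fin m → V} (hc : Function.Injective c)
    (w : Sym2 V → unitInterval)
    (hw : ∀ i j : Fin m, (∀ k : Fin m, s(i, j) ≠ s(k, k + 1)) → w s(c i, c j) = 0)
    (s : Fin m) (n : ℕ) (T : Fin n → Finset V) (hT : ∀ i, ∀ t ∈ T i, t ∈ Set.range c) :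
    0 ≤ sahiE (bernoulliWeight w) n
      (fun i => ind (⋂ t ∈ T i, (openConnIn (Set.range c) (c s) t : Set (BondConfig V)))) := by
  let T' : Fin n → Finset (Fin m) := fun i => univ.filter fun t => c t ∈ T i
  have hT' : ∀ i, (⋂ t ∈ T' i, (openConnIn (Set.range c) (c s) (c t) : Set (BondConfig V))) =
      ⋂ t ∈ T i, (openConnIn (Set.range c) (c s) t : Set (BondConfig V)) := by
    intro i
    ext ω
    simp only [Set.mem_iInter, T', mem_filter, mem_univ, true_and]
    constructor
    · intro h t ht
      obtain ⟨k, rfl⟩ := hT i t ht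
      exact h k ht
    · intro h k hk
      exact h (c k) hk
  have key := sahiE_principal_embeddedCycle_nonneg_rooted hm hc w hw s n T'
  simp only [hT'] at key
  exact key

/-- **Absolute form on a cycle with any root** (`V = Fin m`, `c = id`): `0 ≤ E_n(1_{C_s ⊇ T_i})` for every root
`s`, with `{C_s ⊇ T} = ⋂_{t∈T}{s ↔ t}`. [this work] -/
theorem sahiE_principal_cycle_nonneg_rooted (hm : 3 ≤ m) (w : Sym2 (Fin m) → unitInterval)
    (hw : ∀ e : Sym2 (Fin m), (∀ j : Fin m, e ≠ s(j, j + 1)) → w e = 0) (s : Fin m) (n : ℕ)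
    (T : Fin n → Finset (Fin m)) :
    0 ≤ sahiE (bernoulliWeight w) n
      (fun i => ind (⋂ t ∈ T i, (openConn s t : Set (BondConfig (Fin m))))) := by
  have hid : Function.Injective (id : Fin m → Fin m) := Function.injective_id
  have hw' : ∀ i j : Fin m, (∀ k : Fin m, s(i, j) ≠ s(k, k + 1)) → w s(id i, id j) = 0 :=
    fun i j hij => hw _ hij
  have key := sahiE_principal_embeddedCycle_nonneg_rooted hm hid w hw' s n T
  have hev : ∀ i, (⋂ t ∈ T i, (openConnIn (Set.range (id : Fin m → Fin m)) (id s) (id t) : Set (BondConfig (Fin m))))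
      = ⋂ t ∈ T i, (openConn s t : Set (BondConfig (Fin m))) := by
    intro i
    refine Set.iInter_congr fun t => Set.iInter_congr fun _ => ?_
    ext ω
    rw [Set.range_id]
    exact (BlockExploration.mem_openConn_iff_openConnIn_univ).symm
  simp only [hev] at key
  exact key

/-! ### Edge blocks -/

omit [NeZero m] in
/-- **Principal cluster events of an EDGE block, every order.**  For the block `{a, v}` rooted at `a`, every family
of principal events `⋂_{t∈T_i}{a ↔ t in {a,v}}` (targets among `a, v`) has `E_n ≥ 0`: each event is the sure event
or `{a ↔ v in {a,v}}`, a nested family (Blinovsky / Lieb–Sahi chain case, tree `sahiE_indicator_nonneg_of_total`).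
[this work] -/
theorem sahiE_principal_edge_nonneg (w : Sym2 V → unitInterval) (a v : V) (n : ℕ) (T : Fin n → Finset V)
    (hT : ∀ i, ∀ t ∈ T i, t ∈ ({a, v} : Set V)) :
    0 ≤ sahiE (bernoulliWeight w) n
      (fun i => ind (⋂ t ∈ T i, (openConnIn ({a, v} : Set V) a t : Set (BondConfig V)))) := by
  set X : Set (BondConfig V) := openConnIn ({a, v} : Set V) a v with hX
  set E : Fin n → Set (BondConfig V) := fun i => ⋂ t ∈ T i, (openConnIn ({a, v} : Set V) a t : Set (BondConfig V))
    with hE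
  have ha : a ∈ ({a, v} : Set V) := Set.mem_insert a {v}
  have hT' : ∀ i, ∀ t ∈ T i, t = a ∨ t = v := fun i t ht => by
    rcases Set.mem_insert_iff.1 (hT i t ht) with h | h
    · exact Or.inl h
    · exact Or.inr (Set.mem_singleton_iff.1 h)
  have hXE : ∀ i, X ⊆ E i := by
    intro i ω hω
    simp only [hE, Set.mem_iInter]
    intro t ht
    rcases hT' i t ht with rfl | rfl
    · exact openConnIn_refl ha
    · exact hω
  have hEX : ∀ i, v ∈ T i → E i ⊆ X := by
    intro i hv ω hω
    simp only [hE, Set.mem_iInter] at hω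
    exact hω v hv
  have hEuniv : ∀ i, v ∉ T i → E i = Set.univ := by
    intro i hv
    refine Set.eq_univ_of_forall fun ω => ?_
    simp only [hE, Set.mem_iInter]
    intro t ht
    rcases hT' i t ht with rfl | rfl
    · exact openConnIn_refl ha
    · exact absurd ht hv
  have htot : ∀ i j, E i ⊆ E j ∨ E j ⊆ E i := by
    intro i j
    by_cases hj : v ∈ T j
    · exact Or.inr ((hEX j hj).trans (hXE i))
    · rw [hEuniv j hj]; exact Or.inl (Set.subset_univ _)
  have hind : (fun i => ind (E i)) = fun i => (E i).indicator (1 : BondConfig V → ℝ) := by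
    funext i ω
    by_cases h : ω ∈ E i
    · rw [ind_of_mem h, Set.indicator_of_mem h, Pi.one_apply]
    · rw [ind_of_not_mem h, Set.indicator_of_notMem h]
  show 0 ≤ sahiE (bernoulliWeight w) n (fun i => ind (E i))
  rw [hind]
  exact sahiE_indicator_nonneg_of_total (isFKGMeasure_bernoulliWeight w).nonneg (sum_bernoulliWeight w) E htot

end IncStarCycle

end Summit.CriticalPhenomena.PercolationContinuityZ3.Theorems
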